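import Mathlib
import HarnessLib
import Summits.ValiantsHypothesis.ValiantsHypothesis.Theorems.PermanentalConesDetToVP

/-!
# ValiantsHypothesis / PermanentalCones — `HyperbolicVPShadow`, stub `stub_realify_hermitianPencil`

Route `PermanentalCones`, item `stmt-ValiantsHypothesis-8655` (crux `HyperbolicVPShadow`), line
`birth`, stub `stub_realify_hermitianPencil` (realification of a Hermitian linear pencil).

Let `H` be an `ℝ`-linear pencil of complex `M × M` matrices with every `H x` Hermitian. Write
`K = X + i Y` entrywise (`X = re K`, `Y = im K`) and realify `K ↦ [[X, -Y], [Y, X]]`, an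
`ℝ`-linear map `Matrix (Fin M) (Fin M) ℂ → Matrix (Fin M ⊕ Fin M) (Fin M ⊕ Fin M) ℝ`; reindex
along `Fin M ⊕ Fin M ≃ Fin (2M)`. Then

* the realification of a Hermitian matrix is symmetric (`Xᵀ = X`, `Yᵀ = -Y`);
* the realification of `K + τ·1` (`τ` real) is the realification of `K` plus `τ·1`;
* `det [[X, -Y], [Y, X]] = det (X + iY) · det (X − iY) = det K · conj (det K)` (block
  triangularisation over `ℂ`, `permanentalCones_det_fromBlocks_neg_self`).

Hence the reindexed realified pencil `L` is a symmetric real pencil of size `2M` with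
`det (L x + τ·1) = det (H x + τ·1) · conj (det (H x + τ·1))`.
-/

-- `<Problem> = <Summit>` for this single-conjunct summit (lakefile sets the same option tree-wide).
set_option linter.dupNamespace false

namespace Summit.ValiantsHypothesis.ValiantsHypothesis.Theorems

open Matrix

/-- The realification `[[re K, -im K], [im K, re K]]` of a Hermitian complex matrix `K` is a
symmetric real matrix. [folklore] -/
theorem permanentalCones_isSymm_fromBlocks_re_im {ι : Type*} (K : Matrix ι ι ℂ)
    (hK : K.IsHermitian) :
    (Matrix.fromBlocks (K.map Complex.re) (-(K.map Complex.im)) (K.map Complex.im)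
      (K.map Complex.re)).IsSymm := by
  have hre : ∀ i j, (K j i).re = (K i j).re := fun i j => by
    rw [← hK.apply i j, Complex.star_def, Complex.conj_re]
  have him : ∀ i j, (K i j).im = -(K j i).im := fun i j => by
    rw [← hK.apply i j, Complex.star_def, Complex.conj_im]
  refine Matrix.IsSymm.ext ?_
  rintro (i | i) (j | j)
  · simp [hre i j]
  · simp [him j i]
  · simp [him i j]
  · simp [hre i j]

/-- Realification commutes with adding a real multiple of the identity:
`[[re (K + τ1), -im (K + τ1)], [im (K + τ1), re (K + τ1)]] = [[re K, -im K], [im K, re K]] + τ1`.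
[folklore] -/
theorem permanentalCones_fromBlocks_re_im_add_smul_one {ι : Type*} [DecidableEq ι]
    (K : Matrix ι ι ℂ) (τ : ℝ) :
    Matrix.fromBlocks ((K + (τ : ℂ) • (1 : Matrix ι ι ℂ)).map Complex.re)
        (-((K + (τ : ℂ) • (1 : Matrix ι ι ℂ)).map Complex.im))
        ((K + (τ : ℂ) • (1 : Matrix ι ι ℂ)).map Complex.im)
        ((K + (τ : ℂ) • (1 : Matrix ι ι ℂ)).map Complex.re) =
      Matrix.fromBlocks (K.map Complex.re) (-(K.map Complex.im)) (K.map Complex.im)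
        (K.map Complex.re) + τ • (1 : Matrix (ι ⊕ ι) (ι ⊕ ι) ℝ) := by
  ext (i | i) (j | j)
  · rcases eq_or_ne i j with rfl | h
    · simp
    · simp [h]
  · simp [Matrix.one_apply, apply_ite Complex.im]
  · simp [Matrix.one_apply, apply_ite Complex.im]
  · rcases eq_or_ne i j with rfl | h
    · simp
    · simp [h]

/-- Determinant of the realification: `det [[re K, -im K], [im K, re K]] = det K · conj (det K)`
(as complex numbers), by block triangularisation over `ℂ`. [folklore] -/
theorem permanentalCones_det_fromBlocks_re_im {ι : Type*} [Fintype ι] [DecidableEq ι]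
    (K : Matrix ι ι ℂ) :
    (algebraMap ℝ ℂ) (Matrix.fromBlocks (K.map Complex.re) (-(K.map Complex.im))
      (K.map Complex.im) (K.map Complex.re)).det = K.det * star K.det := by
  have hplus : (K.map Complex.re).map (algebraMap ℝ ℂ) +
      Complex.I • (K.map Complex.im).map (algebraMap ℝ ℂ) = K := by
    ext i j
    simp [Matrix.smul_apply, Complex.ext_iff]
  have hminus : (K.map Complex.re).map (algebraMap ℝ ℂ) -
      Complex.I • (K.map Complex.im).map (algebraMap ℝ ℂ) = K.map (starRingEnd ℂ) := by
    ext i j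
    simp [Matrix.smul_apply, Complex.ext_iff]
  have hstar : star K.det = (starRingEnd ℂ) K.det := rfl
  rw [RingHom.map_det, RingHom.mapMatrix_apply, Matrix.fromBlocks_map,
    Matrix.map_neg _ (map_neg _), permanentalCones_det_fromBlocks_neg_self Complex.I
      Complex.I_mul_I, hplus, hminus, hstar, RingHom.map_det, RingHom.mapMatrix_apply]

/-- **Stub (realification of a Hermitian linear pencil).** If `H` is an `ℝ`-linear pencil of
complex `M × M` matrices with every `H x` Hermitian, then there is an `ℝ`-linear pencil `L` of
real symmetric `2M × 2M` matrices (the reindexed realification `[[re H, -im H], [im H, re H]]`)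
with `det (L x + τ·1) = det (H x + τ·1) · conj (det (H x + τ·1))` for all `x` and real `τ`.
[folklore] -/
theorem stub_realify_hermitianPencil :
    ∀ (n M : ℕ) (H : (Fin n → ℝ) →ₗ[ℝ] Matrix (Fin M) (Fin M) ℂ),
      (∀ x : Fin n → ℝ, (H x).IsHermitian) →
      ∃ L : (Fin n → ℝ) →ₗ[ℝ] Matrix (Fin (2 * M)) (Fin (2 * M)) ℝ,
        (∀ x : Fin n → ℝ, (L x).IsSymm) ∧
        ∀ (x : Fin n → ℝ) (τ : ℝ),
          (algebraMap ℝ ℂ) ((L x + τ • (1 : Matrix (Fin (2 * M)) (Fin (2 * M)) ℝ)).det) =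
            (H x + (τ : ℂ) • (1 : Matrix (Fin M) (Fin M) ℂ)).det *
              star ((H x + (τ : ℂ) • (1 : Matrix (Fin M) (Fin M) ℂ)).det) := by
  intro n M H hH
  -- the realification, as an `ℝ`-linear map
  let RI : Matrix (Fin M) (Fin M) ℂ →ₗ[ℝ] Matrix (Fin M ⊕ Fin M) (Fin M ⊕ Fin M) ℝ :=
    { toFun := fun K => Matrix.fromBlocks (K.map Complex.re) (-(K.map Complex.im))
        (K.map Complex.im) (K.map Complex.re)
      map_add' := fun K K' => by
        ext (i | i) (j | j)
        · simp
        · simp only [Matrix.add_apply, Matrix.fromBlocks_apply₁₂, Matrix.neg_apply,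
            Matrix.map_apply, Complex.add_im, neg_add]
        · simp
        · simp
      map_smul' := fun c K => by
        ext (i | i) (j | j) <;> simp }
  have hRI : ∀ K : Matrix (Fin M) (Fin M) ℂ, RI K = Matrix.fromBlocks (K.map Complex.re)
      (-(K.map Complex.im)) (K.map Complex.im) (K.map Complex.re) := fun K => rfl
  let e : Fin M ⊕ Fin M ≃ Fin (2 * M) := finSumFinEquiv.trans (finCongr (two_mul M).symm)
  refine ⟨(Matrix.reindexLinearEquiv ℝ ℝ e e).toLinearMap ∘ₗ RI ∘ₗ H, fun x => ?_,
    fun x τ => ?_⟩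
  · -- symmetry
    show (Matrix.reindex e e (RI (H x)))ᵀ = Matrix.reindex e e (RI (H x))
    rw [Matrix.transpose_reindex, hRI,
      (permanentalCones_isSymm_fromBlocks_re_im (H x) (hH x)).eq]
  · -- determinant
    have key : ((Matrix.reindexLinearEquiv ℝ ℝ e e).toLinearMap ∘ₗ RI ∘ₗ H) x +
        τ • (1 : Matrix (Fin (2 * M)) (Fin (2 * M)) ℝ) =
        Matrix.reindex e e (RI (H x + (τ : ℂ) • (1 : Matrix (Fin M) (Fin M) ℂ))) := by
      rw [hRI (H x + _), permanentalCones_fromBlocks_re_im_add_smul_one, ← hRI,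
        LinearMap.comp_apply, LinearMap.comp_apply, LinearEquiv.coe_coe,
        ← Matrix.reindexLinearEquiv_one ℝ ℝ e, ← map_smul, ← map_add]
      rfl
    rw [key, Matrix.det_reindex_self, hRI, permanentalCones_det_fromBlocks_re_im]

end Summit.ValiantsHypothesis.ValiantsHypothesis.Theorems
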